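import Literature.Analysis.FluidPDE.TorusLinearisedNSVDataApprox
import Literature.Analysis.FluidPDE.TorusLinearisedNSVDataWindows
import HarnessLib

/-!
# Solutions of the linearised Navier–Stokes equation on `T^d` along a uniformly Gevrey background
# from `V`-data: classical on `(a, b]`, attaining the datum in `H¹`, with a linear `H¹` bound

Analysis/FluidPDE proof file (theorems only; no definitions, no named facts): the existence theorem
for the linearised Navier–Stokes equation along a smooth velocity field `u`,
`∂ₜw + (u·∇)w + (w·∇)u = νΔw − ∇q`, `div w = 0` (Constantin–Foias 1988, Ch. 14, (14.2)–(14.4):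
for `u₀`-trajectories the linearised problem with datum `ξ ∈ H` has a unique solution, Lemma 14.3
and (14.6) for its bounds), for data in `V = H¹_σ` in the classical vocabulary of the tree: the
LINEAR twin of `TorusNSVDataExistence` (strong solutions of the nonlinear system from `V`-data).
Main theorem `Torus.linearisedNS_exists_of_eGradNormSq_ne_top`: on `T^d`, for `ν > 0`, `a < b` and
`u` jointly smooth on `[a, b] × T^d` with divergence-free slices and a uniform Gevrey bound
`∑_{k∈S} e^{2σ₀|k|}‖û(t, k)‖² ≤ C₀`, there is `C` such that every `v₀ ∈ L²`, weakly divergence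
free, mean zero, of finite spectral enstrophy `‖∇v₀‖₂² < ∞`, is attained in `L²` and in `Ḣ¹` as
`t → a⁺` by a jointly smooth solution `(w, q)` of the linearised equation on `(a, b] × T^d` with
divergence-free mean-zero velocity slices, mean-zero pressure, and
`∫ ‖w(t)‖² + ‖∇w(t)‖₂² ≤ C(∫ ‖v₀‖² + ‖∇v₀‖₂²)` on `(a, b]` (`C = e^{K(b−a)}` with the `H¹` growth
rate `K` of `Torus.linearisedNS_exists_h1GrowthRate`).

THE ARGUMENT. The truncations `v_N = P_N v₀` are smooth, divergence free, mean zero with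
`∫ ‖v_N‖² + ‖∇v_N‖₂² ≤ ∫ ‖v₀‖² + ‖∇v₀‖₂²`, so they launch jointly smooth solutions `(w_N, q_N)` on
`[a, b]` (`Torus.linearisedNS_exists`) with `∫ ‖w_N(t)‖² + ‖∇w_N(t)‖₂² ≤ e^{K(b−a)}(∫ ‖v₀‖² + ‖∇v₀‖₂²)`;
by linearity and the Cauchy modulus of the truncations (`Torus.h1DistSq_fourierTruncate_le`) the
`w_N(t)` are `H¹`-Cauchy uniformly in `t`, and uniformly Gevrey at each `t > a`, whence smooth
limit slices `w(t)` (`Torus.linearisedNS_exists_limit_slices`) which solve the equation on `(a, b]`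
with a mean-zero pressure (`Torus.linearisedNS_exists_pressure_of_limit_slices`); the `H¹` bound
passes to the limit (`Torus.integral_norm_sq_add_gradNormSq_le_of_tendsto`) and the datum is attained
by an `ε/3` argument through `w_N(t)` and `v_N` (rate `C'ε_N`, continuity of `w_N` at `t = a`,
`ε_N → 0`). The Gevrey hypothesis on `u` is that of the linear Foias–Temam smoothing estimate
`Torus.linearisedNS_gevrey_of_gevreyBound`; classical Navier–Stokes trajectories under a
trigonometric-polynomial force satisfy it after any time lapse (`TorusNSGevreyBootstrap`).
Deliberately NOT here: merely smooth backgrounds (smoothing by `H^k` estimates of all orders),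
uniqueness in this class (`Torus.linearisedNS_unique` covers jointly smooth solutions on `[a, b]`).

## Tree search

Searched `linearisedNS_exists`, `eGradNormSq_ne_top.*linearised`, `VData`: only the smooth-datum
theorem `Torus.linearisedNS_exists` (`TorusLinearisedNSExistence`) and the nonlinear
`Torus.IsClassicalNSSolutionOn.exists_forced_solution_of_eGradNormSq_le` (`TorusNSVDataExistence`),
whose attainment step is adapted here. Reused: those of the imports.

## References

* P. Constantin, C. Foias, *Navier–Stokes Equations*, Univ. Chicago Press 1988, Ch. 14,
  (14.2)–(14.4), Lemma 14.3. [ConstantinFoiasNSE1988]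
* J. C. Robinson, J. L. Rodrigo, W. Sadowski, *The Three-Dimensional Navier–Stokes Equations*,
  CUP 2016, Lemma 4.1, Thm 6.8. [RobinsonRodrigoSadowskiCUP2016]
-/

noncomputable section

open MeasureTheory Set Function Filter UnitAddTorus
open scoped ContDiff InnerProductSpace Topology ENNReal

namespace Literature.Analysis.FluidPDE

open Literature.Analysis.FunctionSpaces

variable {d : Type*} [Fintype d] [DecidableEq d]

/-- **Solutions of the linearised Navier–Stokes equation on `T^d` from `V`-data along a uniformly
Gevrey background, classical on `(a, b]`, attaining the datum in `H¹`, with a linear `H¹` bound**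
(Constantin–Foias 1988, Ch. 14, (14.2)–(14.4) with Lemma 14.3: the linearised problem along a
trajectory is uniquely solvable from rough data with bounds linear in the datum; here by smooth
approximation, Robinson–Rodrigo–Sadowski 2016, Thm 6.8, in the linear setting). On `T^d` let
`ν > 0`, `σ₀ > 0`, `a < b`, and `u` jointly smooth on `[a, b] × T^d` with divergence-free slices and
`∑_{k∈S} e^{2σ₀|k|}‖𝓕(u t)(k)‖² ≤ C₀` for all `t ∈ [a, b]` and all finite `S`. There is `C` such that
for EVERY `v₀ ∈ L²(T^d; ℝ^d)`, weakly divergence free and mean zero with `eGradNormSq v₀ ≠ ⊤`, there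
are `w`, `q` jointly smooth on `(a, b] × T^d` with `w(t)` divergence free and mean zero, `q(t)` mean
zero, `∂ₜw + (u·∇)w + (w·∇)u = νΔw − ∇q` pointwise on `(a, b]` (one-sided time derivative within
`(a, b]`), `∫ ‖w(t)‖² + ‖∇w(t)‖₂² ≤ C(∫ ‖v₀‖² + (eGradNormSq v₀).toReal)` for `t ∈ (a, b]`, and
`∫ ‖w(t) − v₀‖² → 0`, `eGradNormSq (w(t) − v₀) → 0` as `t → a⁺`.
[cite: ConstantinFoiasNSE1988, Ch. 14 (14.2)–(14.4), Lemma 14.3] -/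
theorem Torus.linearisedNS_exists_of_eGradNormSq_ne_top {ν : ℝ} (hν : 0 < ν) {σ₀ C₀ : ℝ} (hσ₀ : 0 < σ₀)
    {a b : ℝ} (hab : a < b) {u : ℝ → UnitAddTorus d → EuclideanSpace ℝ d}
    (hu : Torus.IsSmoothSpaceTimeOn (Icc a b) u) (hudiv : ∀ t ∈ Icc a b, Torus.IsDivFree (u t))
    (hGev : ∀ t ∈ Icc a b, ∀ S : Finset (d → ℤ),
      ∑ k ∈ S, Real.exp (2 * σ₀ * Real.sqrt (Torus.freqNormSq k)) *
        ‖mFourierCoeff (EuclideanSpace.complexify ∘ u t) k‖ ^ 2 ≤ C₀) :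
    ∃ C : ℝ, ∀ v₀ : UnitAddTorus d → EuclideanSpace ℝ d, MemLp v₀ 2 volume →
      Torus.IsWeaklyDivFree v₀ → Torus.HasZeroMean v₀ → Torus.eGradNormSq v₀ ≠ ⊤ →
      ∃ (w : ℝ → UnitAddTorus d → EuclideanSpace ℝ d) (q : ℝ → UnitAddTorus d → ℝ),
        Torus.IsSmoothSpaceTimeOn (Ioc a b) w ∧ Torus.IsSmoothSpaceTimeOn (Ioc a b) q ∧
        (∀ t ∈ Ioc a b, Torus.IsDivFree (w t)) ∧ (∀ t ∈ Ioc a b, Torus.HasZeroMean (w t)) ∧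
        (∀ t ∈ Ioc a b, ∀ x, Torus.timeDerivWithin (Ioc a b) w t x + Torus.convect (u t) (w t) x +
          Torus.convect (w t) (u t) x = ν • Torus.laplacian (w t) x - Torus.gradient (q t) x) ∧
        (∀ t ∈ Ioc a b, Torus.HasZeroMean (q t)) ∧
        (∀ t ∈ Ioc a b, (∫ x, ‖w t x‖ ^ 2) + Torus.gradNormSq (w t) ≤
          C * ((∫ x, ‖v₀ x‖ ^ 2) + (Torus.eGradNormSq v₀).toReal)) ∧
        Tendsto (fun t => ∫ x, ‖w t x - v₀ x‖ ^ 2) (𝓝[>] a) (𝓝 0) ∧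
        Tendsto (fun t => Torus.eGradNormSq (w t - v₀)) (𝓝[>] a) (𝓝 0) := by
  -- the constant: the one exponential `H¹` rate along `u`
  obtain ⟨K, hK0, hK⟩ := Torus.linearisedNS_exists_h1GrowthRate hν hab hu hudiv
  refine ⟨Real.exp (K * (b - a)), fun v₀ hv₀ hdiv hmean hH => ?_⟩
  have hv₀i : Integrable v₀ volume := hv₀.integrable one_le_two
  -- the data `v_N = P_N v₀` and their `H¹` level
  set vN : ℕ → UnitAddTorus d → EuclideanSpace ℝ d := fun N => Torus.fourierTruncate N v₀ with hvN_def
  have hvNs : ∀ N, Torus.IsSmooth (vN N) := fun N => Torus.isSmooth_fourierTruncate N v₀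
  have hvNdiv : ∀ N, Torus.IsDivFree (vN N) := fun N => Torus.isDivFree_fourierTruncate hv₀ hdiv N
  have hvNmean : ∀ N, Torus.HasZeroMean (vN N) := fun N => Torus.hasZeroMean_fourierTruncate hv₀i hmean N
  set B : ℝ := (∫ x, ‖v₀ x‖ ^ 2) + (Torus.eGradNormSq v₀).toReal with hB_def
  have hB0 : 0 ≤ B := add_nonneg (integral_nonneg fun x => sq_nonneg _) ENNReal.toReal_nonneg
  have hvNB : ∀ N, (∫ x, ‖vN N x‖ ^ 2) + Torus.gradNormSq (vN N) ≤ B := fun N => by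
    have h1 : ∫ x, ‖vN N x‖ ^ 2 ≤ ∫ x, ‖v₀ x‖ ^ 2 := Torus.integral_norm_sq_fourierTruncate_le hv₀ N
    have h2 : Torus.gradNormSq (vN N) ≤ (Torus.eGradNormSq v₀).toReal := by
      rw [Torus.gradNormSq_eq_toReal_eGradNormSq_holds (hvNs N)]
      exact ENNReal.toReal_mono hH (Torus.eGradNormSq_fourierTruncate_le hv₀i N)
    exact add_le_add h1 h2
  -- the approximants on `[a, b]`
  have happrox : ∀ N, ∃ (W : ℝ → UnitAddTorus d → EuclideanSpace ℝ d) (Q : ℝ → UnitAddTorus d → ℝ),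
      Torus.IsSmoothSpaceTimeOn (Icc a b) W ∧ Torus.IsSmoothSpaceTimeOn (Icc a b) Q ∧
      (∀ t ∈ Icc a b, Torus.IsDivFree (W t)) ∧ (∀ t ∈ Icc a b, Torus.HasZeroMean (W t)) ∧
      (∀ t ∈ Icc a b, Torus.HasZeroMean (Q t)) ∧
      (∀ t ∈ Icc a b, ∀ x, Torus.timeDerivWithin (Icc a b) W t x + Torus.convect (u t) (W t) x +
        Torus.convect (W t) (u t) x = ν • Torus.laplacian (W t) x - Torus.gradient (Q t) x) ∧
      W a = vN N := fun N =>
    Torus.linearisedNS_exists hν hab hu hudiv (hvNs N) (hvNdiv N) (hvNmean N)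
  choose w q hw hq hwdiv hwmean _hqmean hlin hw0 using happrox
  have hws : ∀ N, ∀ t ∈ Icc a b, Torus.IsSmooth (w N t) := fun N t ht => (hw N).isSmooth_slice ht
  -- the Cauchy modulus of the data
  set ε : ℕ → ℝ := fun N => (∫ x, ‖vN N x - v₀ x‖ ^ 2) + (Torus.eGradNormSq (vN N - v₀)).toReal
    with hε_def
  have hε : Tendsto ε atTop (𝓝 0) := Torus.tendsto_h1Err_fourierTruncate hv₀ hH
  have hεnn : ∀ N, 0 ≤ ∫ x, ‖vN N x - v₀ x‖ ^ 2 := fun N => integral_nonneg fun _ => sq_nonneg _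
  have hε0 : ∀ N, 0 ≤ ε N := fun N => add_nonneg (hεnn N) ENNReal.toReal_nonneg
  have hpair : ∀ N M, (∫ x, ‖w N a x - w M a x‖ ^ 2) + Torus.gradNormSq (fun x => w N a x - w M a x) ≤
      2 * ε N + 2 * ε M := fun N M => by
    rw [hw0 N, hw0 M]
    exact Torus.h1DistSq_fourierTruncate_le hv₀ hH N M
  have hBN : ∀ N, (∫ x, ‖w N a x‖ ^ 2) + Torus.gradNormSq (w N a) ≤ B := fun N => by
    rw [hw0 N]
    exact hvNB N
  -- the limit slices and the equation on `(a, b]`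
  obtain ⟨wl, C', hwl, hrate⟩ := Torus.linearisedNS_exists_limit_slices hν hσ₀ hab hu hudiv hGev hw hq
    hwdiv hwmean hlin hBN hε hpair
  set C : ℝ := max C' 0 with hC_def
  have hC0 : 0 ≤ C := le_max_right _ _
  have hrate' : ∀ t ∈ Ioc a b, ∀ N, (∫ x, ‖w N t x - wl t x‖ ^ 2) +
      Torus.gradNormSq (fun x => w N t x - wl t x) ≤ C * ε N := fun t ht N =>
    (hrate t ht N).trans (mul_le_mul_of_nonneg_right (le_max_left _ _) (hε0 N))
  have hconv : ∀ t ∈ Ioc a b, Tendsto (fun N => (∫ x, ‖w N t x - wl t x‖ ^ 2) +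
      Torus.gradNormSq (fun x => w N t x - wl t x)) atTop (𝓝 0) := fun t ht => by
    have h := Torus.tendsto_h1_of_h1DistSq_le_mul hε (hrate' t ht)
    simpa using h.1.add h.2
  have hwls : ∀ t ∈ Ioc a b, Torus.IsSmooth (wl t) := fun t ht => (hwl t ht).1
  obtain ⟨p, hwlst, hpst, hpmean, hleq⟩ := Torus.linearisedNS_exists_pressure_of_limit_slices hν hab hu
    hudiv hw hq hwdiv hlin hwls (fun t ht => (hwl t ht).2.1) (fun t ht => (hwl t ht).2.2) hconv
  refine ⟨wl, p, hwlst, hpst, fun t ht => (hwl t ht).2.1, fun t ht => (hwl t ht).2.2, hleq, hpmean,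
    fun t ht => ?_, ?_, ?_⟩
  · -- the `H¹` bound passes to the limit
    have htI : t ∈ Icc a b := ⟨ht.1.le, ht.2⟩
    have hbd : ∀ N, (∫ x, ‖w N t x‖ ^ 2) + Torus.gradNormSq (w N t) ≤ Real.exp (K * (b - a)) * B := by
      intro N
      have h := hK le_rfl (hw N) (hq N) (hwdiv N) (hlin N) t htI
      have hexp : Real.exp (K * (t - a)) ≤ Real.exp (K * (b - a)) :=
        Real.exp_le_exp.2 (mul_le_mul_of_nonneg_left (by linarith [ht.2]) hK0)
      have hnn : 0 ≤ (∫ x, ‖w N a x‖ ^ 2) + Torus.gradNormSq (w N a) :=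
        add_nonneg (integral_nonneg fun x => sq_nonneg _) (Torus.gradNormSq_nonneg _)
      calc (∫ x, ‖w N t x‖ ^ 2) + Torus.gradNormSq (w N t)
          ≤ ((∫ x, ‖w N a x‖ ^ 2) + Torus.gradNormSq (w N a)) * Real.exp (K * (t - a)) := h
        _ ≤ B * Real.exp (K * (b - a)) := mul_le_mul (hBN N) hexp (Real.exp_pos _).le hB0
        _ = Real.exp (K * (b - a)) * B := mul_comm _ _
    have hc := Torus.tendsto_h1_of_h1DistSq_le_mul hε (hrate' t ht)
    exact Torus.integral_norm_sq_add_gradNormSq_le_of_tendsto (fun N => hws N t htI) (hwls t ht) hbd hc.1 hc.2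
  · -- attainment of the datum in `L²` (adapted from `TorusNSVDataExistence`)
    rw [Metric.tendsto_nhds]
    intro δ hδ
    obtain ⟨N, hN⟩ := ((hε.const_mul (4 * C + 4)).eventually_lt_const (by simpa using half_pos hδ)
      |> fun h => (show ∀ᶠ N in atTop, (4 * C + 4) * ε N < δ / 2 by simpa using h)).exists
    have h0N := (hw N).tendsto_integral_norm_sub_sq_nhdsGT hab
    rw [Metric.tendsto_nhds] at h0N
    filter_upwards [h0N (δ / 8) (by positivity), Ioc_mem_nhdsGT hab] with t h1 ht
    have htI : t ∈ Icc a b := ⟨ht.1.le, ht.2⟩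
    rw [Real.dist_eq, sub_zero, abs_of_nonneg (integral_nonneg fun x => sq_nonneg _)] at h1 ⊢
    rw [hw0 N] at h1
    have hA := Torus.integral_norm_sub_sq_le_two_mul_of_memLp ((hwls t ht).memLp 2)
      ((hws N t htI).memLp 2) hv₀ (f := wl t) (g := w N t) (h := v₀)
    have hB := Torus.integral_norm_sub_sq_le_two_mul_of_memLp ((hws N t htI).memLp 2)
      ((hvNs N).memLp 2) hv₀ (f := w N t) (g := vN N) (h := v₀)
    have hC' : ∫ x, ‖wl t x - w N t x‖ ^ 2 ≤ C * ε N := by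
      rw [Torus.integral_norm_sub_sq_comm]
      linarith [hrate' t ht N, Torus.gradNormSq_nonneg (fun x => w N t x - wl t x)]
    have hD : ∫ x, ‖vN N x - v₀ x‖ ^ 2 ≤ ε N := le_add_of_nonneg_right ENNReal.toReal_nonneg
    nlinarith [hA, hB, hC', hD, h1, hN, hC0, hεnn N]
  · -- attainment of the datum in `Ḣ¹` (adapted from `TorusNSVDataExistence`)
    refine ENNReal.tendsto_nhds_zero.2 fun η hη => ?_
    obtain ⟨r, -, hr0, hrη⟩ := ENNReal.lt_iff_exists_real_btwn.1 hη
    have hr : 0 < r := ENNReal.ofReal_pos.1 hr0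
    obtain ⟨N, hN⟩ := ((hε.const_mul (8 * C + 2)).eventually_lt_const (by simpa using half_pos hr)
      |> fun h => (show ∀ᶠ N in atTop, (8 * C + 2) * ε N < r / 2 by simpa using h)).exists
    have h0N := (hw N).tendsto_gradNormSq_sub_nhdsGT hab
    rw [Metric.tendsto_nhds] at h0N
    filter_upwards [h0N (r / 16) (by positivity), Ioc_mem_nhdsGT hab] with t h1 ht
    have htI : t ∈ Icc a b := ⟨ht.1.le, ht.2⟩
    rw [Real.dist_eq, sub_zero, abs_of_nonneg (Torus.gradNormSq_nonneg _), hw0 N] at h1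
    have hust := hwls t ht
    have hUst := hws N t htI
    -- the three pieces
    set gA : ℝ := Torus.gradNormSq (wl t - w N t) with hgA_def
    set gB : ℝ := Torus.gradNormSq (vN N - w N t) with hgB_def
    have hgA0 : 0 ≤ gA := Torus.gradNormSq_nonneg _
    have hgB0 : 0 ≤ gB := Torus.gradNormSq_nonneg _
    have haε : gA ≤ C * ε N := by
      rw [hgA_def, show wl t - w N t = fun x => wl t x - w N t x from rfl, Torus.gradNormSq_sub_comm]
      have h0 : 0 ≤ ∫ x, ‖w N t x - wl t x‖ ^ 2 := integral_nonneg fun x => sq_nonneg _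
      linarith [hrate' t ht N]
    have hbr : gB < r / 16 := by
      rw [hgB_def, show vN N - w N t = fun x => vN N x - w N t x from rfl, Torus.gradNormSq_sub_comm]
      exact h1
    have e2 : ∀ x : ℝ, (2 : ℝ≥0∞) * ENNReal.ofReal x = ENNReal.ofReal (2 * x) := fun x => by
      rw [ENNReal.ofReal_mul zero_le_two, ENNReal.ofReal_ofNat]
    have h1' : Torus.eGradNormSq (vN N - wl t) ≤ ENNReal.ofReal (2 * gB + 2 * gA) := by
      have h := Torus.eGradNormSq_sub_le ((hvNs N).sub hUst).integrable (hust.sub hUst).integrable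
      rw [show vN N - w N t - (wl t - w N t) = vN N - wl t by abel,
        Torus.eGradNormSq_eq_ofReal_gradNormSq (hust.sub hUst),
        Torus.eGradNormSq_eq_ofReal_gradNormSq ((hvNs N).sub hUst), e2 gB,
        e2 gA, ← ENNReal.ofReal_add (by linarith [hgB0]) (by linarith [hgA0])] at h
      exact h
    have h2' : Torus.eGradNormSq (vN N - v₀) ≤ ENNReal.ofReal (ε N) := by
      rw [← ENNReal.ofReal_toReal (Torus.eGradNormSq_fourierTruncate_sub_ne_top hv₀i hH N)]
      exact ENNReal.ofReal_le_ofReal (le_add_of_nonneg_left (hεnn N))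
    have h3 := Torus.eGradNormSq_sub_le ((hvNs N).integrable.sub hv₀i) ((hvNs N).sub hust).integrable
    rw [show vN N - v₀ - (vN N - wl t) = wl t - v₀ by abel] at h3
    calc Torus.eGradNormSq (wl t - v₀)
        ≤ 2 * Torus.eGradNormSq (vN N - v₀) + 2 * Torus.eGradNormSq (vN N - wl t) := h3
      _ ≤ 2 * ENNReal.ofReal (ε N) + 2 * ENNReal.ofReal (2 * gB + 2 * gA) := by gcongr
      _ = ENNReal.ofReal (2 * ε N + 2 * (2 * gB + 2 * gA)) := by
          rw [e2, e2,
            ← ENNReal.ofReal_add (mul_nonneg zero_le_two (hε0 N)) (by linarith [hgA0, hgB0])]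
      _ ≤ ENNReal.ofReal r := ENNReal.ofReal_le_ofReal (by nlinarith [haε, hbr, hN, hC0, hεnn N])
      _ ≤ η := hrη.le

end Literature.Analysis.FluidPDE

end
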